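import Mathlib
import HarnessLib
import Literature.Analysis.FluidPDE.SuitableWeak
import Literature.Analysis.FluidPDE.LerayHopf
import Literature.Analysis.FluidPDE.ClassicalSolution
import Summits.NavierStokesRegularity.NavierStokesRegularity.Theorems.QuarterJoltJoltFlatCell
import Summits.NavierStokesRegularity.NavierStokesRegularity.Theorems.QuarterJoltLocalJoltLaw
import Summits.NavierStokesRegularity.NavierStokesRegularity.Theorems.QuarterJoltCellJoltLaw
import Summits.NavierStokesRegularity.NavierStokesRegularity.Theses.QuarterJolt
import Summits.NavierStokesRegularity.NavierStokesRegularity.Theorems.QuarterJoltTypeIJoltLaw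

/-!
# Route QuarterJolt — crux `NoTerminalJolt` (stmt-NavierStokesRegularity-26463), LEAD line
# `regular_split`: TYPED EDGES OF THE LOCAL FORM OF THE CRUX (to items 1217 and 19625)

Seat ns-ntj-p1 g5 (LEAD of the crux; `--supports 26463 --as helper`), sequel of
`QuarterJoltLocalJoltLaw.lean` / `QuarterJoltCellJoltLaw.lean` / `QuarterJoltLocalNoTerminalJolt.lean`.

`LocalNTJ` is the pointwise-local weakening of the crux: in the frame (classical on `[0,T)`, Leray–Hopf
on `[0,T]`, rapidly decaying datum) every point `x₀` has a ball `B_R(x₀)` on which the local jolt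
functional `D_R(t; x₀) = (√(T−t))⁻¹ ∫_{B_R(x₀)} ‖u(t) − u(T)‖²` tends to `0` as `t ↑ T` (spelled out
inline; no definition, no item). This file records that the two typed edges of the crux which do not
need the global functional survive the weakening:

* `NoTerminalJolt.tendsto_setIntegral_norm_sub_sq_of_tendsto_localJoltFunctional` — no local jolt on
  `B_R(x₀)` ⇒ `∫_{B_R(x₀)} ‖u(t) − u(T)‖² → 0` (local strong `L²` convergence to the terminal value).
* `NoTerminalJolt.noEnergyAtomAt_of_tendsto_localJoltFunctional` — hence NO ENERGY ATOM at `x₀`: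
  `∀ η > 0 ∃ r > 0`, `∫_{B_r(x₀)} ‖u(t)‖² < η` for `t < T` near `T` (Leray–Hopf on `[0,T]` suffices).
* **`noEnergyAtom_of_localNoTerminalJolt : LocalNTJ → ‹stub_noEnergyAtom›`** — the statement of
  WeakLambdaCriterion's `stub_noEnergyAtom` (`Cruxes/WeakLambdaCriterion/Lines/birth.lean`, crux
  stmt-NavierStokesRegularity-19625) VERBATIM, from the local form of the crux (the global edge is
  `noEnergyAtom_of_noTerminalJolt`, `QuarterJoltNoEnergyAtom`, p642579).
* **`noTypeIBlowup_of_localNoTerminalJolt : LocalNTJ → ‹NoTypeIBlowup›`** — shelf statement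
  stmt-NavierStokesRegularity-1217 VERBATIM from the local form of the crux (the cell/local Type-I jolt
  law; the global edge is `noTypeIBlowup_of_noTerminalJolt`, `QuarterJoltTypeIJoltLaw`, p629148), and
  the still weaker cell form `noTypeIBlowup_of_cellNoTerminalJolt` («at every point the jolt cells
  flatten» ⇒ 1217).

* `NoTerminalJolt.exists_cellJoltPoint_of_sliceLaw` / `…_of_enstrophyQuarterLaw` — under the slice
  quarter law at a first blow-up (resp. the route's first crux `EnstrophyQuarterLaw`, stmt-1574, BY NAME)
  every first blow-up in the frame has a CELL JOLT POINT: the localised form of the terminal jolt law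
  `terminalJoltLaw` (p619871) — «a quarter-law blow-up approaches u(T) at the self-similar L² rate IN
  EVERY PARABOLIC CELL at some singular point».

HONEST FRAMING: conditional implications between OPEN statements (the local/cell forms of stmt-26463,
stmt-1217, stmt-19625's stub); nothing is asserted about any of them, no summit statement is proved,
Navier–Stokes regularity stays OPEN. Lint note: inherits the known `theses-cone` advisory of its
imports. [folklore]
-/

noncomputable section

-- the summit and its single sub-problem share the name (CONVENTIONS §1), as in every Theorems file
set_option linter.dupNamespace false

namespace Summit.NavierStokesRegularity.NavierStokesRegularity.Theorems

open MeasureTheory Set Function Filter Topology Metric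
open scoped NNReal ENNReal
open Literature.Analysis.FluidPDE

namespace NoTerminalJolt

/-! ### No local jolt ⇒ local strong convergence ⇒ no energy atom at the point -/

/-- **No local jolt on a ball ⇒ local strong `L²` convergence on that ball**: if
`(√(T−t))⁻¹ ∫_{B_R(x₀)} ‖u(t) − u(T)‖² → 0` as `t ↑ T` then `∫_{B_R(x₀)} ‖u(t) − u(T)‖² → 0` (the product
of two quantities tending to `0`). Pure bookkeeping, no hypothesis on `u`. -/
theorem tendsto_setIntegral_norm_sub_sq_of_tendsto_localJoltFunctional {T : ℝ}
    {u : ℝ → EuclideanSpace ℝ (Fin 3) → EuclideanSpace ℝ (Fin 3)}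
    (x₀ : EuclideanSpace ℝ (Fin 3)) (R : ℝ)
    (hJ : Tendsto (fun t : ℝ => (Real.sqrt (T - t))⁻¹ * ∫ x in ball x₀ R, ‖u t x - u T x‖ ^ 2)
      (𝓝[<] T) (𝓝 0)) :
    Tendsto (fun t : ℝ => ∫ x in ball x₀ R, ‖u t x - u T x‖ ^ 2) (𝓝[<] T) (𝓝 0) := by
  have hsub : Tendsto (fun t : ℝ => T - t) (𝓝[<] T) (𝓝 0) := by
    have h : Tendsto (fun t : ℝ => T - t) (𝓝 T) (𝓝 (T - T)) := tendsto_const_nhds.sub tendsto_id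
    rw [sub_self] at h
    exact tendsto_nhdsWithin_of_tendsto_nhds h
  have hsqrt : Tendsto (fun t : ℝ => Real.sqrt (T - t)) (𝓝[<] T) (𝓝 0) := by
    have h := (Real.continuous_sqrt.tendsto 0).comp hsub
    rwa [Function.comp_def, Real.sqrt_zero] at h
  have hprod := hsqrt.mul hJ
  rw [mul_zero] at hprod
  refine hprod.congr' ?_
  filter_upwards [self_mem_nhdsWithin] with t ht
  have hpos : 0 < Real.sqrt (T - t) := Real.sqrt_pos.2 (sub_pos.2 ht)
  rw [← mul_assoc, mul_inv_cancel₀ hpos.ne', one_mul]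

/-- **No local jolt at `x₀` ⇒ no energy atom at `x₀`.** For a Leray–Hopf solution on `[0,T]` (`T > 0`):
if for some `R > 0` the local jolt functional `(√(T−t))⁻¹ ∫_{B_R(x₀)} ‖u(t) − u(T)‖²` tends to `0` as
`t ↑ T`, then for every `η > 0` there is `r > 0` with `∫_{B_r(x₀)} ‖u(t)‖² < η` for all `t < T` near `T`
(`∫_{B_r}|u(t)|² ≤ 2∫_{B_R}|u(t) − u(T)|² + 2∫_{B_r}|u(T)|²`, `r ≤ R`, absolute continuity of
`|u(T)|² dx`). Local version of `exists_ball_forall_eventually_lt_of_tendsto_eLpNorm_sub`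
(`QuarterJoltNoEnergyAtom`). [folklore] -/
theorem noEnergyAtomAt_of_tendsto_localJoltFunctional {ν T : ℝ} (hT : 0 < T)
    {u : ℝ → EuclideanSpace ℝ (Fin 3) → EuclideanSpace ℝ (Fin 3)}
    (hLH : IsLerayHopfOn T ν 0 (u 0) u) (x₀ : EuclideanSpace ℝ (Fin 3)) {R : ℝ} (hR : 0 < R)
    (hJ : Tendsto (fun t : ℝ => (Real.sqrt (T - t))⁻¹ * ∫ x in ball x₀ R, ‖u t x - u T x‖ ^ 2)
      (𝓝[<] T) (𝓝 0))
    {η : NNReal} (hη : 0 < η) :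
    ∃ r : ℝ, 0 < r ∧ ∀ᶠ t in 𝓝[<] T, ∫⁻ x in ball x₀ r, ‖u t x‖ₑ ^ 2 < (η : ℝ≥0∞) := by
  have hmT : MemLp (u T) 2 volume := hLH.memLp T ⟨hT.le, le_rfl⟩
  -- threshold `δ = (η/2)/2`
  set δ : ℝ≥0∞ := (η : ℝ≥0∞) / 2 / 2 with hδ
  have hη' : (η : ℝ≥0∞) ≠ 0 := by exact_mod_cast hη.ne'
  have hδ0 : 0 < δ := by
    rw [hδ]; exact ENNReal.div_pos (ENNReal.div_pos hη' (by norm_num)).ne' (by norm_num)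
  -- (1) small balls carry little terminal energy
  have h2T : ∫⁻ x, ‖u T x‖ₑ ^ 2 ≠ ⊤ := by
    rw [JoltFlatCell.lintegral_enorm_sq_eq_ofReal hmT]
    exact ENNReal.ofReal_ne_top
  have hvol : Tendsto (fun r : ℝ => volume (ball x₀ r)) (𝓝[>] 0) (𝓝 0) := by
    have hball : ∀ r : ℝ, 0 < r → volume (ball x₀ r) =
        ENNReal.ofReal (r ^ 3) * volume (ball (0 : EuclideanSpace ℝ (Fin 3)) 1) := by
      intro r hr
      rw [Measure.addHaar_ball volume x₀ hr.le, finrank_euclideanSpace_fin]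
    have h0 : Tendsto (fun r : ℝ => ENNReal.ofReal (r ^ 3) *
        volume (ball (0 : EuclideanSpace ℝ (Fin 3)) 1)) (𝓝[>] 0) (𝓝 0) := by
      have h1 : Tendsto (fun r : ℝ => r ^ 3) (𝓝[>] (0 : ℝ)) (𝓝 0) := by
        have := ((continuous_pow 3).tendsto (0 : ℝ))
        rw [zero_pow (by norm_num)] at this
        exact tendsto_nhdsWithin_of_tendsto_nhds this
      have h2 : Tendsto (fun r : ℝ => ENNReal.ofReal (r ^ 3)) (𝓝[>] (0 : ℝ)) (𝓝 0) := by
        rw [← ENNReal.ofReal_zero]; exact ENNReal.tendsto_ofReal h1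
      have h3 := ENNReal.Tendsto.mul_const h2
        (Or.inr (measure_ball_lt_top (μ := (volume : Measure (EuclideanSpace ℝ (Fin 3))))
          (x := (0 : EuclideanSpace ℝ (Fin 3))) (r := 1)).ne)
      rwa [zero_mul] at h3
    refine h0.congr' ?_
    filter_upwards [self_mem_nhdsWithin] with r hr
    exact (hball r hr).symm
  have hsmall := tendsto_setLIntegral_zero (μ := volume) h2T hvol
  obtain ⟨r₁, hr₁, hr₁pos⟩ := ((hsmall.eventually (gt_mem_nhds hδ0)).and self_mem_nhdsWithin).exists
  -- the radius: below `r₁` and below `R`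
  refine ⟨min r₁ R, lt_min hr₁pos hR, ?_⟩
  have hballs₁ : ball x₀ (min r₁ R) ⊆ ball x₀ r₁ := ball_subset_ball (min_le_left _ _)
  have hballsR : ball x₀ (min r₁ R) ⊆ ball x₀ R := ball_subset_ball (min_le_right _ _)
  -- (2) the local `L²` distance on `B_R(x₀)` is eventually small
  have hdist : Tendsto (fun t : ℝ => ENNReal.ofReal (∫ x in ball x₀ R, ‖u t x - u T x‖ ^ 2))
      (𝓝[<] T) (𝓝 0) := by
    rw [← ENNReal.ofReal_zero]
    exact ENNReal.tendsto_ofReal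
      (tendsto_setIntegral_norm_sub_sq_of_tendsto_localJoltFunctional x₀ R hJ)
  filter_upwards [hdist.eventually (gt_mem_nhds hδ0), Ioo_mem_nhdsLT hT] with t ht ht0T
  have hmt : MemLp (u t) 2 volume := hLH.memLp t ⟨ht0T.1.le, ht0T.2.le⟩
  have hL_t : ∫⁻ x in ball x₀ R, ‖u t x - u T x‖ₑ ^ 2 < δ := by
    rw [JoltFlatCell.lintegral_enorm_sq_eq_ofReal_integral (f := fun x => u t x - u T x)
      ((hmt.sub hmT).restrict (ball x₀ R))]
    exact ht
  -- (3) combine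
  calc ∫⁻ x in ball x₀ (min r₁ R), ‖u t x‖ₑ ^ 2
      ≤ 2 * (∫⁻ x in ball x₀ (min r₁ R), ‖u t x - u T x‖ₑ ^ 2) +
          2 * ∫⁻ x in ball x₀ (min r₁ R), ‖u T x‖ₑ ^ 2 :=
        JoltFlatCell.setLIntegral_enorm_sq_le hmT.1 _
    _ ≤ 2 * (∫⁻ x in ball x₀ R, ‖u t x - u T x‖ₑ ^ 2) + 2 * ∫⁻ x in ball x₀ r₁, ‖u T x‖ₑ ^ 2 :=
        add_le_add (mul_le_mul_right (lintegral_mono_set hballsR) 2)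
          (mul_le_mul_right (lintegral_mono_set hballs₁) 2)
    _ < 2 * δ + 2 * δ := by
        have hA : 2 * (∫⁻ x in ball x₀ R, ‖u t x - u T x‖ₑ ^ 2) < 2 * δ := by
          rw [mul_comm 2 (∫⁻ x in ball x₀ R, ‖u t x - u T x‖ₑ ^ 2), mul_comm 2 δ]
          exact ENNReal.mul_lt_mul_left (by norm_num) (by norm_num) hL_t
        have hB : 2 * ∫⁻ x in ball x₀ r₁, ‖u T x‖ₑ ^ 2 < 2 * δ := by
          rw [mul_comm 2 (∫⁻ x in ball x₀ r₁, ‖u T x‖ₑ ^ 2), mul_comm 2 δ]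
          exact ENNReal.mul_lt_mul_left (by norm_num) (by norm_num) hr₁
        exact ENNReal.add_lt_add hA hB
    _ = (η : ℝ≥0∞) := by
        rw [hδ, two_mul, ENNReal.add_halves, ENNReal.add_halves]

end NoTerminalJolt

/-! ### The cell jolt law under the slice quarter law -/

/-- **Slice quarter law at a first blow-up ⇒ a cell jolt point.** A MAXIMAL classical solution on
`[0,T)`, Leray–Hopf on `[0,T]` from a rapidly decaying datum, obeying the slice law
`∫|curl u(t)|² ≤ K/√(T−t)` on `[0,T)`, has a point `x₀` and a `δ > 0` such that every parabolic cell
`Q_ρ(T, x₀)` contains a slice with `∫_{B_ρ(x₀)}‖u(t) − u(T)‖² ≥ δ√(T−t)` (Type I from the slice law by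
`RecordTimeTypeI.main`, then `NoTerminalJolt.typeI_exists_cellJoltPoint`). Localises `terminalJoltLaw`
(p619871). [folklore] -/
theorem NoTerminalJolt.exists_cellJoltPoint_of_sliceLaw {ν T : ℝ} (hν : 0 < ν) (hT : 0 < T)
    {u : ℝ → EuclideanSpace ℝ (Fin 3) → EuclideanSpace ℝ (Fin 3)}
    {p : ℝ → EuclideanSpace ℝ (Fin 3) → ℝ}
    (hmax : IsMaximalSmoothSolution ν 0 u p T) (hLH : IsLerayHopfOn T ν 0 (u 0) u)
    (hdec : HasRapidSpatialDecay (u 0)) (K : ℝ)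
    (hK : ∀ t ∈ Ico 0 T, ∫⁻ x, ‖curl (u t) x‖ₑ ^ 2 ≤ ENNReal.ofReal (K / Real.sqrt (T - t))) :
    ∃ x₀ : EuclideanSpace ℝ (Fin 3), ∃ δ : ℝ, 0 < δ ∧ ∀ ρ : ℝ, 0 < ρ → ∃ t ∈ Ioo (T - ρ ^ 2) T,
      δ ≤ (Real.sqrt (T - t))⁻¹ * ∫ x in ball x₀ ρ, ‖u t x - u T x‖ ^ 2 :=
  NoTerminalJolt.typeI_exists_cellJoltPoint hν hT hmax hLH hdec
    (RecordTimeTypeI.main hν hT hmax.1 hLH hdec K hK)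

/-- **`EnstrophyQuarterLaw` ⇒ every first blow-up in the frame has a cell jolt point** (route crux
stmt-1574 BY NAME as hypothesis): the localised TERMINAL JOLT LAW of the route — a quarter-law blow-up
approaches its terminal value at the self-similar `L²` rate inside every parabolic cell at some singular
point. Conditional on the OPEN crux EQL; nothing is asserted about it. [folklore] -/
theorem NoTerminalJolt.exists_cellJoltPoint_of_enstrophyQuarterLaw
    (hQ : Theses.QuarterJolt.EnstrophyQuarterLaw) {ν T : ℝ} (hν : 0 < ν) (hT : 0 < T)
    {u : ℝ → EuclideanSpace ℝ (Fin 3) → EuclideanSpace ℝ (Fin 3)}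
    {p : ℝ → EuclideanSpace ℝ (Fin 3) → ℝ}
    (hmax : IsMaximalSmoothSolution ν 0 u p T) (hLH : IsLerayHopfOn T ν 0 (u 0) u)
    (hdec : HasRapidSpatialDecay (u 0)) :
    ∃ x₀ : EuclideanSpace ℝ (Fin 3), ∃ δ : ℝ, 0 < δ ∧ ∀ ρ : ℝ, 0 < ρ → ∃ t ∈ Ioo (T - ρ ^ 2) T,
      δ ≤ (Real.sqrt (T - t))⁻¹ * ∫ x in ball x₀ ρ, ‖u t x - u T x‖ ^ 2 :=
  NoTerminalJolt.typeI_exists_cellJoltPoint hν hT hmax hLH hdec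
    (noTypeII_of_enstrophyQuarterLaw hQ ν T hν hT u p hmax hLH hdec)

/-! ### Typed edges of the local form of the crux -/

/-- **`LocalNTJ ⇒ no energy atom`**: the pointwise-local form of the crux (spelled out) implies the
statement of stub `stub_noEnergyAtom` of `Cruxes/WeakLambdaCriterion/Lines/birth.lean` (crux
stmt-NavierStokesRegularity-19625) VERBATIM — every frame solution is atom-free at every point at its
terminal time. Conditional on an OPEN statement; nothing is asserted about it. [folklore] -/
theorem noEnergyAtom_of_localNoTerminalJolt
    (hJloc : ∀ (ν T : ℝ), 0 < ν → 0 < T →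
      ∀ (u : ℝ → EuclideanSpace ℝ (Fin 3) → EuclideanSpace ℝ (Fin 3))
        (p : ℝ → EuclideanSpace ℝ (Fin 3) → ℝ),
        Literature.Analysis.FluidPDE.IsClassicalNSSolutionOn (Set.Ico 0 T) ν 0 u p →
        Literature.Analysis.FluidPDE.IsLerayHopfOn T ν 0 (u 0) u →
        Literature.Analysis.FluidPDE.HasRapidSpatialDecay (u 0) →
        ∀ x₀ : EuclideanSpace ℝ (Fin 3), ∃ R : ℝ, 0 < R ∧
          Filter.Tendsto
            (fun t : ℝ => (Real.sqrt (T - t))⁻¹ * ∫ x in Metric.ball x₀ R, ‖u t x - u T x‖ ^ 2)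
            (nhdsWithin T (Set.Iio T)) (nhds 0)) :
    ∀ (ν T : ℝ), 0 < ν → 0 < T →
      ∀ (u : ℝ → EuclideanSpace ℝ (Fin 3) → EuclideanSpace ℝ (Fin 3))
        (p : ℝ → EuclideanSpace ℝ (Fin 3) → ℝ),
        Literature.Analysis.FluidPDE.IsClassicalNSSolutionOn (Set.Ico 0 T) ν 0 u p →
        Literature.Analysis.FluidPDE.IsLerayHopfOn T ν 0 (u 0) u →
        Literature.Analysis.FluidPDE.HasRapidSpatialDecay (u 0) →
        ∀ (x₀ : EuclideanSpace ℝ (Fin 3)) (η : NNReal), 0 < η →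
          ∃ r : ℝ, 0 < r ∧ ∀ᶠ t in 𝓝[<] T,
            ∫⁻ x in Metric.ball x₀ r, ‖u t x‖ₑ ^ 2 < (η : ENNReal) := by
  intro ν T hν hT u p hcl hLH hdec x₀ η hη
  obtain ⟨R, hR, hJR⟩ := hJloc ν T hν hT u p hcl hLH hdec x₀
  exact NoTerminalJolt.noEnergyAtomAt_of_tendsto_localJoltFunctional hT hLH x₀ hR hJR hη

/-- **`LocalNTJ ⇒ NoTypeIBlowup`**: the pointwise-local form of the crux (spelled out) implies shelf
statement stmt-NavierStokesRegularity-1217 VERBATIM — in the frame, a solution with the Type-I rate at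
`T` extends smoothly past `T` (local Type-I jolt law / continuation criterion
`NoTerminalJolt.hasSmoothExtensionPast_of_isTypeIBlowup_of_localNoJolt`). WEAKENS the hypothesis of
`noTypeIBlowup_of_noTerminalJolt` (p629148). Conditional on an OPEN statement. [folklore] -/
theorem noTypeIBlowup_of_localNoTerminalJolt
    (hJloc : ∀ (ν T : ℝ), 0 < ν → 0 < T →
      ∀ (u : ℝ → EuclideanSpace ℝ (Fin 3) → EuclideanSpace ℝ (Fin 3))
        (p : ℝ → EuclideanSpace ℝ (Fin 3) → ℝ),
        Literature.Analysis.FluidPDE.IsClassicalNSSolutionOn (Set.Ico 0 T) ν 0 u p →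
        Literature.Analysis.FluidPDE.IsLerayHopfOn T ν 0 (u 0) u →
        Literature.Analysis.FluidPDE.HasRapidSpatialDecay (u 0) →
        ∀ x₀ : EuclideanSpace ℝ (Fin 3), ∃ R : ℝ, 0 < R ∧
          Filter.Tendsto
            (fun t : ℝ => (Real.sqrt (T - t))⁻¹ * ∫ x in Metric.ball x₀ R, ‖u t x - u T x‖ ^ 2)
            (nhdsWithin T (Set.Iio T)) (nhds 0)) :
    ∀ (ν T : ℝ), 0 < ν → 0 < T →
      ∀ (u : ℝ → EuclideanSpace ℝ (Fin 3) → EuclideanSpace ℝ (Fin 3))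
        (p : ℝ → EuclideanSpace ℝ (Fin 3) → ℝ),
        Literature.Analysis.FluidPDE.IsClassicalNSSolutionOn (Set.Ico 0 T) ν 0 u p →
        Literature.Analysis.FluidPDE.IsLerayHopfOn T ν 0 (u 0) u →
        Literature.Analysis.FluidPDE.HasRapidSpatialDecay (u 0) →
        Literature.Analysis.FluidPDE.IsTypeIBlowup u T →
        Literature.Analysis.FluidPDE.HasSmoothExtensionPast ν 0 u T := by
  intro ν T hν hT u p hcl hLH hdec hTI
  exact NoTerminalJolt.hasSmoothExtensionPast_of_isTypeIBlowup_of_localNoJolt hν hT hcl hLH hdec hTI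
    (hJloc ν T hν hT u p hcl hLH hdec)

/-- **`CellNTJ ⇒ NoTypeIBlowup`**: even the CELL form of the crux («in the frame, at every point the
jolt cells flatten: `∀ x₀ ∀ δ > 0 ∃ ρ₀ > 0 ∀ ρ ∈ (0,ρ₀) ∀ t ∈ (T−ρ², T): D_ρ(t; x₀) < δ`», the weakest
no-jolt statement of the series, spelled out) implies shelf statement stmt-1217 VERBATIM
(`NoTerminalJolt.hasSmoothExtensionPast_of_isTypeIBlowup_of_cellNoJolt`). Conditional on an OPEN
statement. [folklore] -/
theorem noTypeIBlowup_of_cellNoTerminalJolt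
    (hJcell : ∀ (ν T : ℝ), 0 < ν → 0 < T →
      ∀ (u : ℝ → EuclideanSpace ℝ (Fin 3) → EuclideanSpace ℝ (Fin 3))
        (p : ℝ → EuclideanSpace ℝ (Fin 3) → ℝ),
        Literature.Analysis.FluidPDE.IsClassicalNSSolutionOn (Set.Ico 0 T) ν 0 u p →
        Literature.Analysis.FluidPDE.IsLerayHopfOn T ν 0 (u 0) u →
        Literature.Analysis.FluidPDE.HasRapidSpatialDecay (u 0) →
        ∀ x₀ : EuclideanSpace ℝ (Fin 3), ∀ δ : ℝ, 0 < δ → ∃ ρ₀ : ℝ, 0 < ρ₀ ∧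
          ∀ ρ : ℝ, 0 < ρ → ρ < ρ₀ → ∀ t ∈ Set.Ioo (T - ρ ^ 2) T,
            (Real.sqrt (T - t))⁻¹ * ∫ x in Metric.ball x₀ ρ, ‖u t x - u T x‖ ^ 2 < δ) :
    ∀ (ν T : ℝ), 0 < ν → 0 < T →
      ∀ (u : ℝ → EuclideanSpace ℝ (Fin 3) → EuclideanSpace ℝ (Fin 3))
        (p : ℝ → EuclideanSpace ℝ (Fin 3) → ℝ),
        Literature.Analysis.FluidPDE.IsClassicalNSSolutionOn (Set.Ico 0 T) ν 0 u p →
        Literature.Analysis.FluidPDE.IsLerayHopfOn T ν 0 (u 0) u →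
        Literature.Analysis.FluidPDE.HasRapidSpatialDecay (u 0) →
        Literature.Analysis.FluidPDE.IsTypeIBlowup u T →
        Literature.Analysis.FluidPDE.HasSmoothExtensionPast ν 0 u T := by
  intro ν T hν hT u p hcl hLH hdec hTI
  exact NoTerminalJolt.hasSmoothExtensionPast_of_isTypeIBlowup_of_cellNoJolt hν hT hcl hLH hdec hTI
    (hJcell ν T hν hT u p hcl hLH hdec)

end Summit.NavierStokesRegularity.NavierStokesRegularity.Theorems

end
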